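import Mathlib
import Summits.Ventures.PercRepro2.Defs
import Summits.Ventures.PercRepro2.Independence
import Summits.Ventures.PercRepro2.Harris
import Summits.Ventures.PercRepro2.Graph
import Summits.Ventures.PercRepro2.Events
import Summits.Ventures.PercRepro2.BHKEvents
import Summits.Ventures.PercRepro2.RProduct
import Summits.Ventures.PercRepro2.RestrictClosure
import Summits.Ventures.PercRepro2.RootPairSepDefs

/-!
# Root-pair separation: the per-side bracket of the weighted (PM) decomposes across `{a₁, a₂}`
(blind cell PercRepro2, mine-2 g21; proofs/MINE2-CUTU.md §10 Theorem 7; definitions in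
`RootPairSepDefs.lean`).  If the roots separate the vertex set (`IsRootPairSep`), every `a₁`–`a₂`
path lies inside one side, so on `Q = {a₁ ↮ a₂}` root connections localise inside their side
(`conn_side₁`, `conn_side₂`), `Q` splits into the two restricted non-connections
(`compl_conn_iff_restrict`) and the two sides are conditionally independent given `Q`
(`prob_side_mul`).  The consequences for the cleared L-half of the weighted (PM) are in `RootPairSepPM.lean`.
-/

namespace Summit.Ventures.PercRepro2

namespace RootPairSep

open SepPair

section Sep

variable {V : Type*} {E : Type*}

/-- An edge with both endpoints in `V₁` lies inside `V₁`. -/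
lemma mem_side₁_of_ends {ends : E → Sym2 V} {V₁ : Set V} {e : E} {x y : V}
    (hends : ends e = s(x, y)) (hx : x ∈ V₁) (hy : y ∈ V₁) : e ∈ side₁ ends V₁ := by
  intro x' y' h'
  rcases Sym2.eq_iff.1 (hends.symm.trans h') with ⟨rfl, rfl⟩ | ⟨rfl, rfl⟩
  · exact ⟨hx, hy⟩
  · exact ⟨hy, hx⟩

/-- An edge not inside `V₁` lies inside `V₂`. -/
lemma mem_side₂_of_not_side₁ {ends : E → Sym2 V} {a₁ a₂ : V} {V₁ V₂ : Set V}
    (hs : IsRootPairSep ends a₁ a₂ V₁ V₂) {e : E} {x y : V} (hends : ends e = s(x, y))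
    (he : e ∉ side₁ ends V₁) : x ∈ V₂ ∧ y ∈ V₂ := by
  rcases hs.edge_side e x y hends with ⟨hx, hy⟩ | h
  · exact absurd (mem_side₁_of_ends hends hx hy) he
  · exact h

/-- Inside the edges of `V₁`, nothing leaves `V₁`. -/
lemma reach_side₁ {ends : E → Sym2 V} {V₁ : Set V} [DecidablePred (· ∈ side₁ ends V₁)]
    {ω : Config E} {v z : V} (hv : v ∈ V₁)
    (h : Conn ends (restrictTo (side₁ ends V₁) ω) v z) : z ∈ V₁ := by
  refine mem_of_conn_of_closed' (S := V₁) ?_ hv h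
  intro e x y he hends hx
  exact ((mem_and_open_of_restrictTo he).1 x y hends).2

/-- Inside the edges outside `side₁`, nothing leaves `V₂`. -/
lemma reach_side₂ {ends : E → Sym2 V} {a₁ a₂ : V} {V₁ V₂ : Set V}
    (hs : IsRootPairSep ends a₁ a₂ V₁ V₂) [DecidablePred (· ∈ (side₁ ends V₁)ᶜ)]
    {ω : Config E} {v z : V} (hv : v ∈ V₂)
    (h : Conn ends (restrictTo (side₁ ends V₁)ᶜ ω) v z) : z ∈ V₂ := by
  refine mem_of_conn_of_closed' (S := V₂) ?_ hv h
  intro e x y he hends _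
  exact (mem_side₂_of_not_side₁ hs hends (mem_and_open_of_restrictTo he).1).2

/-- The exit hypothesis for `side₁`: an open edge leaving `side₁` from a vertex reached inside
`side₁` from `v ∈ V₁` starts at a root. -/
lemma exit₁ {ends : E → Sym2 V} {a₁ a₂ : V} {V₁ V₂ : Set V}
    (hs : IsRootPairSep ends a₁ a₂ V₁ V₂) [DecidablePred (· ∈ side₁ ends V₁)]
    (ω : Config E) {v : V} (hv : v ∈ V₁) :
    ∀ e x y, ω e = true → ends e = s(x, y) → e ∉ side₁ ends V₁ →
      Conn ends (restrictTo (side₁ ends V₁) ω) v x → x ∈ ({a₁, a₂} : Set V) := by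
  intro e x y _ hends he hx
  have hx₁ : x ∈ V₁ := reach_side₁ hv hx
  have hx₂ : x ∈ V₂ := (mem_side₂_of_not_side₁ hs hends he).1
  exact hs.inter_sub ⟨hx₁, hx₂⟩

/-- The exit hypothesis for the complement of `side₁`. -/
lemma exit₂ {ends : E → Sym2 V} {a₁ a₂ : V} {V₁ V₂ : Set V}
    (hs : IsRootPairSep ends a₁ a₂ V₁ V₂) [DecidablePred (· ∈ (side₁ ends V₁)ᶜ)]
    (ω : Config E) {v : V} (hv : v ∈ V₂) :
    ∀ e x y, ω e = true → ends e = s(x, y) → e ∉ (side₁ ends V₁)ᶜ →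
      Conn ends (restrictTo (side₁ ends V₁)ᶜ ω) v x → x ∈ ({a₁, a₂} : Set V) := by
  intro e x y _ hends he hx
  have he' : e ∈ side₁ ends V₁ := by simpa using he
  have hx₁ : x ∈ V₁ := (he' x y hends).1
  have hx₂ : x ∈ V₂ := reach_side₂ hs hv hx
  exact hs.inter_sub ⟨hx₁, hx₂⟩

/-- On `{a₁ ↮ a₂}`, a connection from a root to `v ∈ V₁` lives inside `side₁`. -/
lemma conn_side₁ {ends : E → Sym2 V} {a₁ a₂ : V} {V₁ V₂ : Set V}
    (hs : IsRootPairSep ends a₁ a₂ V₁ V₂) [DecidablePred (· ∈ side₁ ends V₁)]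
    {ω : Config E} (hD : ω ∈ (connEvent ends a₁ a₂)ᶜ) {i : V} (hi : i = a₁ ∨ i = a₂)
    {v : V} (hv : v ∈ V₁) :
    ω ∈ connEvent ends i v ↔ restrictTo (side₁ ends V₁) ω ∈ connEvent ends i v := by
  constructor
  · intro h
    exact conn_symm (conn_restrictTo_of_not_conn (exit₁ hs ω hv) hD hi (conn_symm h))
  · intro h
    exact conn_of_conn_restrictTo h

/-- On `{a₁ ↮ a₂}`, a connection from a root to `v ∈ V₂` lives outside `side₁`. -/
lemma conn_side₂ {ends : E → Sym2 V} {a₁ a₂ : V} {V₁ V₂ : Set V}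
    (hs : IsRootPairSep ends a₁ a₂ V₁ V₂) [DecidablePred (· ∈ (side₁ ends V₁)ᶜ)]
    {ω : Config E} (hD : ω ∈ (connEvent ends a₁ a₂)ᶜ) {i : V} (hi : i = a₁ ∨ i = a₂)
    {v : V} (hv : v ∈ V₂) :
    ω ∈ connEvent ends i v ↔ restrictTo (side₁ ends V₁)ᶜ ω ∈ connEvent ends i v := by
  constructor
  · intro h
    exact conn_symm (conn_restrictTo_of_not_conn (exit₂ hs ω hv) hD hi (conn_symm h))
  · intro h
    exact conn_of_conn_restrictTo h

/-- `{a₁ ↮ a₂}` is the intersection of the two restricted non-connection events. -/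
lemma compl_conn_iff_restrict {ends : E → Sym2 V} {a₁ a₂ : V} {V₁ V₂ : Set V}
    (hs : IsRootPairSep ends a₁ a₂ V₁ V₂) [DecidablePred (· ∈ side₁ ends V₁)]
    [DecidablePred (· ∈ (side₁ ends V₁)ᶜ)] (ω : Config E) :
    ω ∈ (connEvent ends a₁ a₂)ᶜ ↔
      restrictTo (side₁ ends V₁) ω ∈ (connEvent ends a₁ a₂)ᶜ ∧
        restrictTo (side₁ ends V₁)ᶜ ω ∈ (connEvent ends a₁ a₂)ᶜ := by
  constructor
  · intro hD
    exact ⟨fun h => hD (conn_of_conn_restrictTo h), fun h => hD (conn_of_conn_restrictTo h)⟩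
  · rintro ⟨h₁, h₂⟩ hc
    have h₁' : ¬ Conn ends (restrictTo (side₁ ends V₁) ω) a₁ a₂ := h₁
    have h₂' : ¬ Conn ends (restrictTo (side₁ ends V₁)ᶜ ω) a₁ a₂ := h₂
    -- the set of vertices reached from `a₁` inside one of the two sides is closed
    let S : Set V := {z | Conn ends (restrictTo (side₁ ends V₁) ω) a₁ z ∨
      Conn ends (restrictTo (side₁ ends V₁)ᶜ ω) a₁ z}
    have ha₁S : a₁ ∈ S := Or.inl (conn_refl _ _ _)
    have hclosed : ∀ e x y, ω e = true → ends e = s(x, y) → x ∈ S → y ∈ S := by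
      intro e x y he hends hx
      rcases hx with hx | hx
      · by_cases heF : e ∈ side₁ ends V₁
        · exact Or.inl (conn_trans hx (conn_of_openAdj ⟨e, restrictTo_eq_true_of_mem heF he, hends⟩))
        · have hx₁ : x ∈ V₁ := reach_side₁ hs.a₁_mem.1 hx
          have hx₂ : x ∈ V₂ := (mem_side₂_of_not_side₁ hs hends heF).1
          have hxr : x ∈ ({a₁, a₂} : Set V) := hs.inter_sub ⟨hx₁, hx₂⟩
          simp only [Set.mem_insert_iff, Set.mem_singleton_iff] at hxr
          rcases hxr with rfl | rfl
          · have heF' : e ∈ (side₁ ends V₁)ᶜ := heF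
            exact Or.inr (conn_of_openAdj ⟨e, restrictTo_eq_true_of_mem heF' he, hends⟩)
          · exact absurd hx h₁'
      · by_cases heF : e ∈ (side₁ ends V₁)ᶜ
        · exact Or.inr (conn_trans hx (conn_of_openAdj ⟨e, restrictTo_eq_true_of_mem heF he, hends⟩))
        · have heF' : e ∈ side₁ ends V₁ := by simpa using heF
          have hx₁ : x ∈ V₁ := (heF' x y hends).1
          have hx₂ : x ∈ V₂ := reach_side₂ hs hs.a₁_mem.2 hx
          have hxr : x ∈ ({a₁, a₂} : Set V) := hs.inter_sub ⟨hx₁, hx₂⟩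
          simp only [Set.mem_insert_iff, Set.mem_singleton_iff] at hxr
          rcases hxr with rfl | rfl
          · exact Or.inl (conn_of_openAdj ⟨e, restrictTo_eq_true_of_mem heF' he, hends⟩)
          · exact absurd hx h₂'
    have ha₂S : a₂ ∈ S := mem_of_conn_of_closed' hclosed ha₁S hc
    rcases ha₂S with h | h
    · exact h₁' h
    · exact h₂' h

/-- Side events are closed under intersection. -/
lemma side_inter {F : Set E} [DecidablePred (· ∈ F)] {D X Y : Set (Config E)}
    (hX : ∀ ω ∈ D, ω ∈ X ↔ restrictTo F ω ∈ X) (hY : ∀ ω ∈ D, ω ∈ Y ↔ restrictTo F ω ∈ Y) :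
    ∀ ω ∈ D, ω ∈ X ∩ Y ↔ restrictTo F ω ∈ X ∩ Y := by
  intro ω hω
  have := hX ω hω; have := hY ω hω
  simp only [Set.mem_inter_iff]
  tauto

/-- Side events are closed under union. -/
lemma side_union {F : Set E} [DecidablePred (· ∈ F)] {D X Y : Set (Config E)}
    (hX : ∀ ω ∈ D, ω ∈ X ↔ restrictTo F ω ∈ X) (hY : ∀ ω ∈ D, ω ∈ Y ↔ restrictTo F ω ∈ Y) :
    ∀ ω ∈ D, ω ∈ X ∪ Y ↔ restrictTo F ω ∈ X ∪ Y := by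
  intro ω hω
  have := hX ω hω; have := hY ω hω
  simp only [Set.mem_union]
  tauto

end Sep

section Prob

variable {V : Type*} {E : Type*} [Fintype E] [DecidableEq E] {R : Type*} [CommRing R]

/-- **Conditional independence across the root pair.**  If `X` is determined by the edges of
`V₁` on `Q` and `Y` by the edges outside `V₁` on `Q`, then `P(X ∩ Y ∩ Q) · P(Q) = P(X ∩ Q) · P(Y ∩ Q)`. -/
theorem prob_side_mul (p : E → R) {ends : E → Sym2 V} {a₁ a₂ : V} {V₁ V₂ : Set V}
    (hs : IsRootPairSep ends a₁ a₂ V₁ V₂) [DecidablePred (· ∈ side₁ ends V₁)]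
    [DecidablePred (· ∈ (side₁ ends V₁)ᶜ)] {X Y : Set (Config E)}
    (hX : ∀ ω ∈ (connEvent ends a₁ a₂)ᶜ, ω ∈ X ↔ restrictTo (side₁ ends V₁) ω ∈ X)
    (hY : ∀ ω ∈ (connEvent ends a₁ a₂)ᶜ, ω ∈ Y ↔ restrictTo (side₁ ends V₁)ᶜ ω ∈ Y) :
    prob p (X ∩ Y ∩ (connEvent ends a₁ a₂)ᶜ) * prob p (connEvent ends a₁ a₂)ᶜ =
      prob p (X ∩ (connEvent ends a₁ a₂)ᶜ) * prob p (Y ∩ (connEvent ends a₁ a₂)ᶜ) := by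
  have hDω := fun ω => compl_conn_iff_restrict hs (ω := ω)
  have ind : ∀ A B : Set (Config E),
      prob p (restrictTo (side₁ ends V₁) ⁻¹' A ∩ restrictTo (side₁ ends V₁)ᶜ ⁻¹' B) =
        prob p (restrictTo (side₁ ends V₁) ⁻¹' A) * prob p (restrictTo (side₁ ends V₁)ᶜ ⁻¹' B) :=
    fun A B => prob_inter_eq_mul_of_dependsOn p disjoint_compl_right
      (dependsOn_restrictTo _ A) (dependsOn_restrictTo _ B)
  have e1 : X ∩ Y ∩ (connEvent ends a₁ a₂)ᶜ =
      restrictTo (side₁ ends V₁) ⁻¹' (X ∩ (connEvent ends a₁ a₂)ᶜ) ∩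
        restrictTo (side₁ ends V₁)ᶜ ⁻¹' (Y ∩ (connEvent ends a₁ a₂)ᶜ) := by
    ext ω
    have := hDω ω; have := hX ω; have := hY ω
    simp only [Set.mem_inter_iff, Set.mem_preimage]
    tauto
  have e2 : (connEvent ends a₁ a₂)ᶜ =
      restrictTo (side₁ ends V₁) ⁻¹' (connEvent ends a₁ a₂)ᶜ ∩
        restrictTo (side₁ ends V₁)ᶜ ⁻¹' (connEvent ends a₁ a₂)ᶜ := by
    ext ω
    have := hDω ω
    simp only [Set.mem_inter_iff, Set.mem_preimage]
    tauto
  have e3 : X ∩ (connEvent ends a₁ a₂)ᶜ =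
      restrictTo (side₁ ends V₁) ⁻¹' (X ∩ (connEvent ends a₁ a₂)ᶜ) ∩
        restrictTo (side₁ ends V₁)ᶜ ⁻¹' (connEvent ends a₁ a₂)ᶜ := by
    ext ω
    have := hDω ω; have := hX ω
    simp only [Set.mem_inter_iff, Set.mem_preimage]
    tauto
  have e4 : Y ∩ (connEvent ends a₁ a₂)ᶜ =
      restrictTo (side₁ ends V₁) ⁻¹' (connEvent ends a₁ a₂)ᶜ ∩
        restrictTo (side₁ ends V₁)ᶜ ⁻¹' (Y ∩ (connEvent ends a₁ a₂)ᶜ) := by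
    ext ω
    have := hDω ω; have := hY ω
    simp only [Set.mem_inter_iff, Set.mem_preimage]
    tauto
  have p1 := congrArg (prob p) e1
  have p2 := congrArg (prob p) e2
  have p3 := congrArg (prob p) e3
  have p4 := congrArg (prob p) e4
  rw [ind] at p1 p2 p3 p4
  rw [p1, p2, p3, p4]
  ring

end Prob

end RootPairSep

end Summit.Ventures.PercRepro2
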